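import Summits.CriticalPhenomena.PercolationContinuityZ3.Theorems.PercNearOneGluingNoHeavyLowerTailSunflowerAndrasfaiIso
import HarnessLib

/-!
# `NoHeavyLowerTail` (crux stmt-CriticalPhenomena-4575), abstract sunflower cubic: WHICH GRAPHS THE ANDRÁSFAI THEOREM COVERS —
# ℤ₃-chain labellings = induced subgraphs of Andrásfai graphs, hence A-safe

Support file (seat `prim-ineq-prove-1` gen 48; `--supports stmt-CriticalPhenomena-4575`).  No `sorry`, no named facts, standard axioms.
Memo: run/shared/lean/prim/prim-ineq-prove-1/FINDING-MOVEP-prove1-g48.md §1 (structure remark).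

The Andrásfai graph `andrasfai k` (…SunflowerAndrasfai) lives on `Fin (3k+2)` with `u ~ v` iff the difference of the labels is
`≡ 1 (mod 3)` (read from the smaller to the larger).  Consequently a graph `Γ` is an INDUCED SUBGRAPH of some Andrásfai graph iff it
admits a **ℤ₃-chain labelling**: an injective position map `pos : ι → ℕ` and residues `lab : ι → Fin 3` such that for `pos u < pos v`
one has `u ~ v ↔ lab v = lab u + 1` (`Z3Chain`; the three residue classes are independent sets, consecutive classes are joined by
chain graphs read cyclically).  This file proves both directions of the correspondence (`Z3Chain.emb`, `z3ChainOfEmbedding`) and draws the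
consequence of `Arc.andrasfaiSafe_holds` (gen 42) and `aSafe_of_embedding`:
* **`safe_of_z3Chain`**: a graph with a ℤ₃-chain labelling has an A-safe graph core (Lemma A `∏ μ(V_i) ≤ μ(A)^(K-1)` for every number of
  petals and every product measure), and so does every blow-up of it (`safe_comap_of_z3Chain`).
So "is `Γ` covered by the Andrásfai theorem?" becomes a finite search for a labelling (e.g. `C₅`, `C₇ = K_{7/3}`, `K_{10/4}`, chain graphs:
yes; `C₉`, `X₉`, Petersen, Grötzsch: no — memo §1).
-/

noncomputable section

namespace Summit.CriticalPhenomena.PercolationContinuityZ3.Theorems.SunflowerPartition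

namespace SafeCalc

open Finset

variable {ι : Type*} [Fintype ι]

/-- A **ℤ₃-chain labelling** of `Γ`: injective positions and residues mod 3 such that, reading from the earlier to the later vertex,
adjacency means "residue goes up by one". [this work] -/
structure Z3Chain (Γ : SimpleGraph ι) where
  /-- position of a vertex (injective) -/
  pos : ι → ℕ
  /-- residue class of a vertex -/
  lab : ι → Fin 3
  /-- positions are distinct -/
  pos_injective : Function.Injective pos
  /-- for `pos u < pos v`: `u ~ v ↔ lab v = lab u + 1` -/
  adj_iff : ∀ u v, pos u < pos v → (Γ.Adj u v ↔ lab v = lab u + 1)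

namespace Z3Chain

variable {Γ : SimpleGraph ι} (c : Z3Chain Γ)

/-- A size parameter: every position is `< c.size`. [this work] -/
def size : ℕ := univ.sup c.pos + 1

/-- Positions are below `size`. -/
theorem pos_lt_size (x : ι) : c.pos x < c.size := by
  have : c.pos x ≤ univ.sup c.pos := Finset.le_sup (f := c.pos) (mem_univ x)
  unfold size; omega

/-- The vertex map into `Fin (3·size + 2)`: `x ↦ 3·pos x + lab x`. [this work] -/
def phi (x : ι) : Fin (3 * c.size + 2) :=
  ⟨3 * c.pos x + (c.lab x).val, by have := c.pos_lt_size x; have := (c.lab x).isLt; omega⟩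

/-- Value of `phi`. -/
@[simp] theorem phi_val (x : ι) : ((c.phi x : Fin (3 * c.size + 2)) : ℕ) = 3 * c.pos x + (c.lab x).val := rfl

/-- `phi` is injective (positions are recovered as the quotient by `3`). -/
theorem phi_injective : Function.Injective c.phi := by
  intro x y h
  have hv := congrArg Fin.val h
  rw [phi_val, phi_val] at hv
  have hx := (c.lab x).isLt; have hy := (c.lab y).isLt
  exact c.pos_injective (by omega)

/-- In `Fin 3`: `b = a + 1 ↔ (b + 3 − a) % 3 = 1` on values. -/
theorem fin3_eq_add_one_iff (a b : Fin 3) : b = a + 1 ↔ (b.val + 3 - a.val) % 3 = 1 := by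
  revert a b; decide

/-- Adjacency is transported: for `pos u < pos v`, `andrasfai.Adj (phi u) (phi v) ↔ Γ.Adj u v`. -/
theorem adj_phi_of_lt {u v : ι} (h : c.pos u < c.pos v) : (andrasfai c.size).Adj (c.phi u) (c.phi v) ↔ Γ.Adj u v := by
  rw [c.adj_iff u v h, fin3_eq_add_one_iff]
  change ((c.phi u).val < (c.phi v).val ∧ ((c.phi v).val - (c.phi u).val) % 3 = 1 ∨
    (c.phi v).val < (c.phi u).val ∧ ((c.phi u).val - (c.phi v).val) % 3 = 1) ↔ _
  rw [phi_val, phi_val]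
  have hu := (c.lab u).isLt; have hv := (c.lab v).isLt
  have hlt : 3 * c.pos u + (c.lab u).val < 3 * c.pos v + (c.lab v).val := by omega
  have e : (3 * c.pos v + (c.lab v).val - (3 * c.pos u + (c.lab u).val)) % 3 = ((c.lab v).val + 3 - (c.lab u).val) % 3 := by
    have : 3 * c.pos v + (c.lab v).val - (3 * c.pos u + (c.lab u).val) =
        3 * (c.pos v - c.pos u - 1) + ((c.lab v).val + 3 - (c.lab u).val) := by omega
    rw [this, Nat.mul_add_mod]
  constructor
  · rintro (⟨-, h1⟩ | ⟨h1, -⟩)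
    · rwa [e] at h1
    · omega
  · intro h1
    exact Or.inl ⟨hlt, by rwa [e]⟩

/-- **The embedding `Γ ↪g andrasfai c.size` given by a ℤ₃-chain labelling.** [this work] -/
def emb : Γ ↪g andrasfai c.size where
  toFun := c.phi
  inj' := c.phi_injective
  map_rel_iff' := by
    intro u v
    change (andrasfai c.size).Adj (c.phi u) (c.phi v) ↔ Γ.Adj u v
    rcases lt_trichotomy (c.pos u) (c.pos v) with h | h | h
    · exact c.adj_phi_of_lt h
    · have huv : u = v := c.pos_injective h
      subst huv
      simp only [SimpleGraph.irrefl]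
    · rw [SimpleGraph.adj_comm, c.adj_phi_of_lt h, SimpleGraph.adj_comm]

end Z3Chain

/-- **THEOREM.  A graph with a ℤ₃-chain labelling has an A-safe graph core** — it is an induced subgraph of an Andrásfai graph
(`Z3Chain.emb`), and those are A-safe (`andrasfaiSafe_holds`, heredity `aSafe_of_embedding`). [this work] -/
theorem safe_of_z3Chain {Γ : SimpleGraph ι} (c : Z3Chain Γ) (p : ι → unitInterval) : Safe p (edgeCore Γ) :=
  aSafe_of_embedding c.emb (fun q => Arc.andrasfaiSafe_holds c.size q) p

/-- And so does every blow-up of such a graph. [this work] -/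
theorem safe_comap_of_z3Chain {κ : Type*} [Fintype κ] {Γ : SimpleGraph ι} (c : Z3Chain Γ) (f : κ → ι) (p : κ → unitInterval) :
    Safe p (edgeCore (Γ.comap f)) :=
  aSafe_edgeCore_comap f Γ (fun q => safe_of_z3Chain c q) p

/-- **Converse: an induced subgraph of an Andrásfai graph has a ℤ₃-chain labelling** (positions = labels of the image, residues = labels
mod 3), so `Z3Chain` characterises the induced subgraphs of Andrásfai graphs. [this work] -/
def z3ChainOfEmbedding {Γ : SimpleGraph ι} {k : ℕ} (f : Γ ↪g andrasfai k) : Z3Chain Γ where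
  pos := fun x => (f x).val
  lab := fun x => ⟨(f x).val % 3, Nat.mod_lt _ (by omega)⟩
  pos_injective := fun x y h => f.injective (Fin.ext h)
  adj_iff := by
    intro u v h
    rw [← f.map_adj_iff, Z3Chain.fin3_eq_add_one_iff]
    change ((f u).val < (f v).val ∧ ((f v).val - (f u).val) % 3 = 1 ∨
      (f v).val < (f u).val ∧ ((f u).val - (f v).val) % 3 = 1) ↔ _
    change (f u).val < (f v).val at h
    have e : ((f v).val - (f u).val) % 3 = ((f v).val % 3 + 3 - (f u).val % 3) % 3 := by omega
    constructor
    · rintro (⟨-, h1⟩ | ⟨h1, -⟩)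
      · rw [e] at h1; exact h1
      · omega
    · intro h1
      exact Or.inl ⟨h, by rw [e]; exact h1⟩

end SafeCalc

end Summit.CriticalPhenomena.PercolationContinuityZ3.Theorems.SunflowerPartition
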